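import Literature.Geometry.Lorentzian.ChartPieceInequalities
import Literature.Geometry.Lorentzian.EndSobolev
import Literature.Geometry.Lorentzian.ScalarCurvatureIntegrable
import Literature.Geometry.Lorentzian.VolumePositivity
import Literature.Geometry.Lorentzian.ConformalScalarFlatCore
import HarnessLib

/-!
# The Sobolev inequality on the core of a one-ended asymptotically flat 3-manifold

Second half of Schoen–Yau 1979, Lemma 3.1 (Comm. Math. Phys. 65, p. 63): after the end `N_k`
has been treated by the Euclidean inequality (`EndSobolev.lean`), the remaining part of a test
function lives on a fixed compact region of `N`, where the Sobolev inequality "follows from a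
standard partition of unity argument together with the Poincaré inequality" — here: a finite
cover of the compact core `K = X ∖ far(3s)` by coordinate balls, the Poincaré–Wirtinger and local
Sobolev inequalities on each ball (`ChartPieceInequalities.lean`), Maz'ya's gluing of Poincaré
inequalities along the (connected) cover (`PoincareGluing.lean`), and the vanishing of the
function on the nonempty open part `far(2s) ∩ Ω` of the covered region to dispose of the mean
value. Main results:

* `AFEnd.isPreconnected_compl_far` — on a connected `X`, the core `X ∖ far(t)` (`t > R`) is
  preconnected (the coordinate sphere `{‖coord‖ = t}` is connected, and a separation of the core
  would produce a nontrivial clopen subset of `X`);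
* `AFEnd.exists_core_sobolev` — for a smooth Riemannian metric `h` on a connected `X` with a
  sole asymptotically flat end `e` and `s > R` there is `C < ∞` with
  `‖f‖_{L⁶(X, μ_h)} ≤ C (∫_X h⁻¹(df, df) dμ_h)^{1/2}` for every `f ∈ C¹(X)` vanishing on `far(2s)`.

All statements are proved; no named facts are introduced.

## References

* R. Schoen, S.-T. Yau, Comm. Math. Phys. 65 (1979) 45–76, Lemma 3.1 and its proof (p. 63).
* V. G. Maz'ja, *Sobolev Spaces* (1985), §1.1.11.
* E. Hebey, *Nonlinear Analysis on Manifolds* (1999), Thm. 3.5 ff.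
-/

noncomputable section

open Set Function Filter Metric MeasureTheory Measure TopologicalSpace Manifold Bundle Module
open scoped Topology Manifold ContDiff ENNReal NNReal

namespace Literature.Geometry.Lorentzian

open Literature.Analysis.FunctionSpaces

namespace AFEnd

variable {X : Type} [TopologicalSpace X] [ChartedSpace E3 X] (e : AFEnd X)

/-! ### Topology of the core -/

/-- Off the end, `coord` is the junk value `0`. [folklore] -/
private theorem coord_of_not_mem₃ {q : X} (hq : q ∉ e.U) : e.coord q = 0 := by
  classical
  exact dif_neg hq

/-- The closed far piece `{q ∈ U | s ≤ ‖coord q‖}` through `coord`. [folklore] -/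
private theorem mem_closedFar_iff₃ {s : ℝ} {q : X} :
    q ∈ ((↑) : e.U → X) '' (e.chart ⁻¹' {x | s ≤ ‖(x : E3)‖}) ↔ ∃ _ : q ∈ e.U, s ≤ ‖e.coord q‖ := by
  constructor
  · rintro ⟨u, hu, rfl⟩
    refine ⟨u.2, ?_⟩
    rw [e.coord_of_mem u.2]
    simpa using hu
  · rintro ⟨hq, hR⟩
    refine ⟨⟨q, hq⟩, ?_, rfl⟩
    rw [e.coord_of_mem hq] at hR
    simpa using hR

/-- **The coordinate sphere `{q ∈ U | ‖coord q‖ = t}` (`t > R`) is preconnected**: it is the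
image of the round sphere of radius `t` in `ℝ³` under the continuous inverse chart. [folklore] -/
theorem isPreconnected_coordSphere {t : ℝ} (ht : e.R < t) :
    IsPreconnected {q : X | ∃ _ : q ∈ e.U, ‖e.coord q‖ = t} := by
  have hsub : sphere (0 : E3) t ⊆ {z : E3 | e.R < ‖z‖} := fun z hz ↦ by
    rw [mem_setOf_eq, mem_sphere_zero_iff_norm.1 hz]
    exact ht
  have hcont : ContinuousOn e.dataChartExt (sphere (0 : E3) t) := fun z hz ↦
    (e.contMDiffAt_dataChartExt (hsub hz)).continuousAt.continuousWithinAt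
  have hrank : 1 < Module.rank ℝ E3 := by
    rw [← Module.finrank_eq_rank, finrank_euclideanSpace_fin]
    norm_num
  have himg : e.dataChartExt '' sphere (0 : E3) t = {q : X | ∃ _ : q ∈ e.U, ‖e.coord q‖ = t} := by
    ext q
    constructor
    · rintro ⟨z, hz, rfl⟩
      have hzR : e.R < ‖z‖ := hsub hz
      rw [e.dataChartExt_of_lt hzR]
      refine ⟨(e.chart.symm ⟨z, hzR⟩).2, ?_⟩
      rw [e.coord_dataChart ⟨z, hzR⟩]
      exact mem_sphere_zero_iff_norm.1 hz
    · rintro ⟨hq, hqt⟩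
      have hzR : e.R < ‖e.coord q‖ := by rw [hqt]; exact ht
      refine ⟨e.coord q, mem_sphere_zero_iff_norm.2 hqt, ?_⟩
      rw [e.dataChartExt_of_lt hzR]
      exact e.dataChart_coord hq
  rw [← himg]
  exact (isPreconnected_sphere hrank 0 t).image _ hcont

/-- **The core of a connected manifold with an asymptotically flat end is preconnected**:
`X ∖ far(t)` is preconnected for `t > R`. Write the core as the union of the open set
`W = X ∖ {q ∈ U | t ≤ ‖coord q‖}` and the coordinate sphere `S = {‖coord‖ = t}`, which is
connected; if open sets `u, v` separated the core, `S` would lie in one of them, say `u`, and then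
`core ∩ v = W ∩ v` would be a nonempty proper clopen subset of `X`. [folklore] -/
theorem isPreconnected_compl_far [ConnectedSpace X] {t : ℝ} (ht : e.R < t) :
    IsPreconnected (e.far t)ᶜ := by
  set K : Set X := (e.far t)ᶜ with hK
  set C : Set X := ((↑) : e.U → X) '' (e.chart ⁻¹' {x | t ≤ ‖(x : E3)‖}) with hC
  set W : Set X := Cᶜ with hW
  set S : Set X := {q : X | ∃ _ : q ∈ e.U, ‖e.coord q‖ = t} with hS
  have hWo : IsOpen W := (e.isClosed_far t ht).isOpen_compl
  have hKcl : IsClosed K := (e.isOpen_far t).isClosed_compl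
  have hSconn : IsPreconnected S := e.isPreconnected_coordSphere ht
  -- `K = W ∪ S`, `S ⊆ K`, `W ⊆ K`
  have hmemK : ∀ q, q ∈ K ↔ ¬ ∃ _ : q ∈ e.U, t < ‖e.coord q‖ := fun q ↦ by
    rw [hK, mem_compl_iff, e.mem_far_iff_coord]
  have hWK : W ⊆ K := by
    intro q hq
    rw [hmemK]
    rintro ⟨hqU, hqt⟩
    exact hq (e.mem_closedFar_iff₃.2 ⟨hqU, hqt.le⟩)
  have hSK : S ⊆ K := by
    rintro q ⟨hqU, hqt⟩
    rw [hmemK]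
    rintro ⟨-, hqt'⟩
    rw [hqt] at hqt'
    exact lt_irrefl _ hqt'
  have hKWS : K ⊆ W ∪ S := by
    intro q hq
    by_cases hqW : q ∈ W
    · exact Or.inl hqW
    · right
      rw [hW, mem_compl_iff, not_not, e.mem_closedFar_iff₃] at hqW
      obtain ⟨hqU, hqt⟩ := hqW
      refine ⟨hqU, le_antisymm ?_ hqt⟩
      by_contra hlt
      exact (hmemK q).1 hq ⟨hqU, not_le.1 hlt⟩
  -- the separation argument
  intro u v hu hv hKuv hKu hKv
  by_contra hemp
  rw [not_nonempty_iff_eq_empty] at hemp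
  -- `S` lies in `u` or in `v`
  have hSuv : S ∩ u = ∅ ∨ S ∩ v = ∅ := by
    rcases Set.eq_empty_or_nonempty (S ∩ u) with h1 | h1
    · exact Or.inl h1
    rcases Set.eq_empty_or_nonempty (S ∩ v) with h2 | h2
    · exact Or.inr h2
    exfalso
    have h := hSconn u v hu hv (hSK.trans hKuv) h1 h2
    obtain ⟨q, hqS, hquv⟩ := h
    have : q ∈ K ∩ (u ∩ v) := ⟨hSK hqS, hquv⟩
    rw [hemp] at this
    exact this
  -- the clopen set
  have key : ∀ (u v : Set X), IsOpen u → IsOpen v → K ⊆ u ∪ v → (K ∩ u).Nonempty → (K ∩ v).Nonempty →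
      K ∩ (u ∩ v) = ∅ → S ∩ v = ∅ → False := by
    intro u v hu hv hKuv hKu hKv hemp hSv
    set B : Set X := K ∩ v with hB
    have hBo : IsOpen B := by
      have hBeq : B = W ∩ v := by
        apply subset_antisymm
        · rintro q ⟨hqK, hqv⟩
          rcases hKWS hqK with hqW | hqS
          · exact ⟨hqW, hqv⟩
          · have : q ∈ S ∩ v := ⟨hqS, hqv⟩
            rw [hSv] at this
            exact absurd this (notMem_empty q)
        · rintro q ⟨hqW, hqv⟩
          exact ⟨hWK hqW, hqv⟩
      rw [hBeq]
      exact hWo.inter hv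
    have hBc : IsClosed B := by
      have hBeq : B = K ∩ uᶜ := by
        apply subset_antisymm
        · rintro q ⟨hqK, hqv⟩
          refine ⟨hqK, fun hqu ↦ ?_⟩
          have : q ∈ K ∩ (u ∩ v) := ⟨hqK, hqu, hqv⟩
          rw [hemp] at this
          exact this
        · rintro q ⟨hqK, hqu⟩
          rcases hKuv hqK with h | h
          · exact absurd h hqu
          · exact ⟨hqK, h⟩
      rw [hBeq]
      exact hKcl.inter hu.isClosed_compl
    have hclopen : IsClopen B := ⟨hBc, hBo⟩
    rcases isClopen_iff.1 hclopen with h0 | h1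
    · rw [h0] at hKv
      exact not_nonempty_empty hKv
    · obtain ⟨q, hqK, hqu⟩ := hKu
      have hqB : q ∈ B := by rw [h1]; exact mem_univ q
      have : q ∈ K ∩ (u ∩ v) := ⟨hqK, hqu, hqB.2⟩
      rw [hemp] at this
      exact this
  rcases hSuv with hSu | hSv
  · exact key v u hv hu (by rwa [union_comm]) hKv hKu (by rwa [inter_comm v u]) hSu
  · exact key u v hu hv hKuv hKu hKv hemp hSv

/-- **The core is compact** for a sole end: `X ∖ far(t)` is a closed subset of the compact set
of `IsSoleEnd.exists_isCompact_cover`. [folklore] -/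
theorem isCompact_compl_far [IsManifold (𝓡 3) ∞ X] {e : AFEnd X} (hsole : e.IsSoleEnd) (t : ℝ) :
    IsCompact (e.far t)ᶜ := by
  obtain ⟨K', hK', hcov⟩ := hsole.exists_isCompact_cover t
  exact hK'.of_isClosed_subset (e.isOpen_far t).isClosed_compl fun p hp ↦ (hcov p).resolve_right hp

/-! ### The Sobolev inequality on the core -/

section Core

variable [IsManifold (𝓡 3) ∞ X] [T2Space X] [LocallyCompactSpace X] [ConnectedSpace X]
  [MeasurableSpace X] [BorelSpace X]
  (h : ContMDiffRiemannianMetric (𝓡 3) ∞ E3 (TangentSpace (𝓡 3) : X → Type _))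

omit [IsManifold (𝓡 3) ∞ X] [T2Space X] [LocallyCompactSpace X] [ConnectedSpace X] [MeasurableSpace X]
  [BorelSpace X] in
/-- A point of the core inside `far(2s)`: `Φ(z)` with `‖z‖ = 5s/2`. [folklore] -/
theorem exists_mem_compl_far_mem_far {s : ℝ} (hs : e.R < s) :
    ∃ q : X, q ∈ (e.far (3 * s))ᶜ ∧ q ∈ e.far (2 * s) := by
  have hs0 : 0 < s := e.R_pos.trans hs
  set z : E3 := (5 * s / 2) • EuclideanSpace.single (0 : Fin 3) (1 : ℝ) with hz
  have hzn : ‖z‖ = 5 * s / 2 := by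
    rw [hz, norm_smul, Real.norm_of_nonneg (by positivity)]
    simp
  have hzR : e.R < ‖z‖ := by rw [hzn]; linarith
  refine ⟨e.dataChart ⟨z, hzR⟩, ?_, e.dataChart_mem_far (by change 2 * s < ‖z‖; rw [hzn]; linarith)⟩
  rw [mem_compl_iff, e.mem_far_iff_coord, not_exists]
  intro _ hlt
  rw [e.coord_dataChart ⟨z, hzR⟩] at hlt
  change 3 * s < ‖z‖ at hlt
  rw [hzn] at hlt
  linarith

/-- **The Sobolev inequality on the core of a one-ended asymptotically flat `3`-manifold**
(Schoen–Yau 1979, proof of Lemma 3.1: the "standard partition of unity argument together with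
the Poincaré inequality" on the compact part, p. 63). Let `h` be a smooth Riemannian metric on a
connected `3`-manifold `X` with an asymptotically flat end `e` which is its only end, and
`s > R`. There is `C < ∞` such that for every `f ∈ C¹(X)` vanishing on `far(2s)`,
`‖f‖_{L⁶(X, μ_h)} ≤ C (∫_X h⁻¹(df, df) dμ_h)^{1/2}`.
Proof: cover the compact, preconnected core `K = X ∖ far(3s)` (`isCompact_compl_far`,
`isPreconnected_compl_far`) by finitely many coordinate balls `Uᵢ` (with doubled closed balls
inside the chart targets); `Ω = ⋃ Uᵢ ⊇ K` is open, preconnected and of finite measure. By the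
Poincaré–Wirtinger inequality on each `Uᵢ` (`exists_poincare_chartPiece`) and Maz'ya's gluing
lemma (`exists_eLpNorm_sub_setAverage_le_of_finite_cover`), `‖f − f_Ω‖_{L²(Ω)} ≤ K_G ‖∇f‖₂`;
since `f = 0` on the nonempty open set `Ω ∩ far(2s)`, also `|f_Ω| ≲ ‖∇f‖₂`, whence
`‖f‖_{L²(X)} ≲ ‖∇f‖₂`; finally the local Sobolev inequality on each ball
(`exists_sobolev_chartBall`) gives `‖f‖_{L⁶(X)} ≤ ∑ᵢ ‖f‖_{L⁶(Uᵢ)} ≲ ‖∇f‖₂ + ‖f‖₂ ≲ ‖∇f‖₂`.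
[cite: SchoenYauPMT1979, proof of Lemma 3.1 (p. 63)] -/
theorem exists_core_sobolev (hsole : e.IsSoleEnd) {s : ℝ} (hs : e.R < s) :
    ∃ C : ℝ≥0∞, C ≠ ⊤ ∧ ∀ f : X → ℝ, ContMDiff (𝓡 3) 𝓘(ℝ, ℝ) 1 f →
      (∀ q ∈ e.far (2 * s), f q = 0) →
      eLpNorm f 6 (riemannianMeasure h) ≤
        C * (∫⁻ p, ENNReal.ofReal ((PseudoRiemannianMetric.ofRiemannian h).innerDual p
          (mvfderiv (𝓡 3) f p).toLinearMap (mvfderiv (𝓡 3) f p).toLinearMap) ∂riemannianMeasure h) ^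
          (1 / 2 : ℝ) := by
  classical
  set μ : Measure X := riemannianMeasure h with hμ
  haveI : IsFiniteMeasureOnCompacts μ :=
    ⟨fun K hK ↦ riemannianVolume_lt_top_of_isCompact_holds h le_rfl hK⟩
  haveI : μ.IsOpenPosMeasure := isOpenPosMeasure_riemannianMeasure h
  set g := PseudoRiemannianMetric.ofRiemannian h with hg
  have hs0 : 0 < s := e.R_pos.trans hs
  -- the core
  set t : ℝ := 3 * s with htdef
  have ht : e.R < t := by rw [htdef]; linarith
  set K : Set X := (e.far t)ᶜ with hKdef
  have hKc : IsCompact K := isCompact_compl_far hsole t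
  have hKconn : IsPreconnected K := e.isPreconnected_compl_far ht
  obtain ⟨q₀, hq₀K, hq₀far⟩ := e.exists_mem_compl_far_mem_far (X := X) hs
  -- coordinate balls
  have hball : ∀ q : X, ∃ r : ℝ, 0 < r ∧
      closedBall (extChartAt (𝓡 3) q q) (2 * r) ⊆ (extChartAt (𝓡 3) q).target := by
    intro q
    obtain ⟨ε, hε, hεT⟩ := Metric.nhds_basis_closedBall.mem_iff.1
      ((isOpen_extChartAt_target (I := 𝓡 3) q).mem_nhds (mem_extChartAt_target (I := 𝓡 3) q))
    exact ⟨ε / 2, by positivity, by rwa [show 2 * (ε / 2) = ε by ring]⟩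
  choose r hr hrT using hball
  set piece : X → Set X := fun q ↦
    (extChartAt (𝓡 3) q).source ∩ extChartAt (𝓡 3) q ⁻¹' ball (extChartAt (𝓡 3) q q) (r q) with hpiece
  have hpo : ∀ q, IsOpen (piece q) := fun q ↦ isOpen_extChartAt_preimage' (I := 𝓡 3) q isOpen_ball
  have hpq : ∀ q, q ∈ piece q := fun q ↦
    ⟨mem_extChartAt_source q, by simp only [mem_preimage, mem_ball, dist_self, hr q]⟩
  have hballT : ∀ q, ball (extChartAt (𝓡 3) q q) (r q) ⊆ (extChartAt (𝓡 3) q).target := fun q ↦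
    (ball_subset_closedBall.trans (closedBall_subset_closedBall (by linarith [hr q]))).trans (hrT q)
  have hpconn : ∀ q, IsPreconnected (piece q) := by
    intro q
    have heq : piece q = (extChartAt (𝓡 3) q).symm '' ball (extChartAt (𝓡 3) q q) (r q) :=
      ((extChartAt (𝓡 3) q).symm_image_eq_source_inter_preimage (hballT q)).symm
    rw [heq]
    exact (convex_ball _ _).isPreconnected.image _
      ((continuousOn_extChartAt_symm q).mono (hballT q))
  have hpcpt : ∀ q, piece q ⊆ (extChartAt (𝓡 3) q).symm '' closedBall (extChartAt (𝓡 3) q q) (2 * r q) := by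
    intro q p hp
    exact ⟨extChartAt (𝓡 3) q p, (ball_subset_closedBall.trans
      (closedBall_subset_closedBall (by linarith [hr q]))) hp.2, (extChartAt (𝓡 3) q).left_inv hp.1⟩
  -- a finite subcover of `K`
  obtain ⟨T, hTK, hTcov⟩ := hKc.elim_nhds_subcover piece fun q _ ↦ (hpo q).mem_nhds (hpq q)
  set U : T → Set X := fun i ↦ piece (i : X) with hU
  set Ω : Set X := ⋃ i : T, U i with hΩ
  have hKΩ : K ⊆ Ω := by
    intro p hp
    obtain ⟨q, hqT, hpq'⟩ := mem_iUnion₂.1 (hTcov hp)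
    exact mem_iUnion.2 ⟨⟨q, hqT⟩, hpq'⟩
  have hΩo : IsOpen Ω := isOpen_iUnion fun i ↦ hpo i
  have hΩm : MeasurableSet Ω := hΩo.measurableSet
  have hΩconn : IsPreconnected Ω := by
    have hΩeq : Ω = ⋃ i : T, (U i ∪ K) := by
      apply subset_antisymm
      · exact iUnion_mono fun i ↦ subset_union_left
      · exact iUnion_subset fun i ↦ union_subset (subset_iUnion U i) hKΩ
    rw [hΩeq]
    refine isPreconnected_iUnion ⟨q₀, mem_iInter.2 fun i ↦ Or.inr hq₀K⟩ fun i ↦ ?_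
    exact IsPreconnected.union (i : X) (hpq i) (hTK i i.2) (hpconn i) hKconn
  have hΩcpt : IsCompact (⋃ i : T, (extChartAt (𝓡 3) (i : X)).symm ''
      closedBall (extChartAt (𝓡 3) (i : X) (i : X)) (2 * r i)) :=
    isCompact_iUnion fun i ↦ (isCompact_closedBall _ _).image_of_continuousOn
      ((continuousOn_extChartAt_symm (i : X)).mono (hrT i))
  have hΩsub : Ω ⊆ ⋃ i : T, (extChartAt (𝓡 3) (i : X)).symm ''
      closedBall (extChartAt (𝓡 3) (i : X) (i : X)) (2 * r i) :=
    iUnion_mono fun i ↦ hpcpt i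
  have hμΩ : μ Ω ≠ ⊤ := ((measure_mono hΩsub).trans_lt hΩcpt.measure_lt_top).ne
  -- the zero region
  set Z : Set X := Ω ∩ e.far (2 * s) with hZ
  have hZo : IsOpen Z := hΩo.inter (e.isOpen_far _)
  have hZm : MeasurableSet Z := hZo.measurableSet
  have hZne : Z.Nonempty := ⟨q₀, hKΩ hq₀K, hq₀far⟩
  have hμZ0 : μ Z ≠ 0 := (hZo.measure_pos μ hZne).ne'
  have hμZt : μ Z ≠ ⊤ := ((measure_mono inter_subset_left).trans_lt hμΩ.lt_top).ne
  have hμΩ0 : μ Ω ≠ 0 := fun h0 ↦ hμZ0 (measure_mono_null inter_subset_left h0)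
  -- constants
  have hPoin : ∀ i : T, ∃ C : ℝ≥0∞, C ≠ ⊤ ∧ ∀ f : X → ℝ, ContMDiff (𝓡 3) 𝓘(ℝ, ℝ) 1 f →
      eLpNorm (fun p ↦ f p - ⨍ q in U i, f q ∂μ) 2 (μ.restrict (U i)) ≤
        C * (∫⁻ p, ENNReal.ofReal (g.innerDual p (mvfderiv (𝓡 3) f p).toLinearMap
          (mvfderiv (𝓡 3) f p).toLinearMap) ∂μ) ^ (1 / 2 : ℝ) := by
    intro i
    have hcl : closure (ball (extChartAt (𝓡 3) (i : X) (i : X)) (r i)) =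
        closedBall (extChartAt (𝓡 3) (i : X) (i : X)) (r i) := closure_ball _ (hr i).ne'
    exact exists_poincare_chartPiece h (i : X) isOpen_ball (convex_ball _ _)
      ⟨_, mem_ball_self (hr i)⟩ (by rw [hcl]; exact isCompact_closedBall _ _)
      (by rw [hcl]; exact (closedBall_subset_closedBall (by linarith [hr i])).trans (hrT i))
  choose CP hCPt hCP using hPoin
  have hSob : ∀ i : T, ∃ C : ℝ≥0∞, C ≠ ⊤ ∧ ∀ f : X → ℝ, ContMDiff (𝓡 3) 𝓘(ℝ, ℝ) 1 f →
      eLpNorm f 6 (μ.restrict (U i)) ≤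
        C * ((∫⁻ p, ENNReal.ofReal (g.innerDual p (mvfderiv (𝓡 3) f p).toLinearMap
          (mvfderiv (𝓡 3) f p).toLinearMap) ∂μ) ^ (1 / 2 : ℝ) + eLpNorm f 2 μ) :=
    fun i ↦ exists_sobolev_chartBall h (i : X) (hr i) (hrT i)
  choose CS hCSt hCS using hSob
  obtain ⟨KG, hKGt, hglue⟩ := exists_eLpNorm_sub_setAverage_le_of_finite_cover (μ := μ) (F := ℝ)
    U (fun i ↦ hpo i) rfl hΩconn hμΩ one_le_two CP hCPt
  set K₂ : ℝ≥0∞ := KG * (1 + μ Ω ^ (1 / 2 : ℝ) * (μ Z)⁻¹ ^ (1 / 2 : ℝ)) with hK₂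
  have hK₂t : K₂ ≠ ⊤ := by
    refine ENNReal.mul_ne_top hKGt (ENNReal.add_ne_top.2 ⟨ENNReal.one_ne_top, ENNReal.mul_ne_top
      (ENNReal.rpow_ne_top_of_nonneg (by norm_num) hμΩ)
      (ENNReal.rpow_ne_top_of_nonneg (by norm_num) (ENNReal.inv_ne_top.2 hμZ0))⟩)
  set C : ℝ≥0∞ := (∑ i, CS i) * (1 + K₂) with hC
  have hCt : C ≠ ⊤ := ENNReal.mul_ne_top (ENNReal.sum_ne_top.2 fun i _ ↦ hCSt i)
    (ENNReal.add_ne_top.2 ⟨ENNReal.one_ne_top, hK₂t⟩)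
  refine ⟨C, hCt, fun f hf hf0 ↦ ?_⟩
  have hfc : Continuous f := hf.continuous
  set DIR : ℝ≥0∞ := (∫⁻ p, ENNReal.ofReal (g.innerDual p (mvfderiv (𝓡 3) f p).toLinearMap
    (mvfderiv (𝓡 3) f p).toLinearMap) ∂μ) ^ (1 / 2 : ℝ) with hDIR
  -- `f` vanishes off `Ω`
  have hsuppΩ : support f ⊆ Ω := by
    intro p hp
    refine hKΩ ?_
    rw [hKdef, mem_compl_iff]
    intro hpfar
    exact hp (hf0 p (e.far_mono (by rw [htdef]; linarith) hpfar))
  have hfi : IntegrableOn f Ω μ :=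
    (hfc.continuousOn.integrableOn_compact hΩcpt).mono_set hΩsub
  -- Poincaré on `Ω`
  have hG := hglue f DIR hfi fun i ↦ hCP i f hf
  set c : ℝ := ⨍ p in Ω, f p ∂μ with hc
  -- the mean value is controlled through the zero region
  have hcZ : ‖c‖ₑ * μ Z ^ (1 / 2 : ℝ) ≤ KG * DIR := by
    have h1 : eLpNorm (fun p ↦ f p - c) 2 (μ.restrict Z) = ‖c‖ₑ * μ Z ^ (1 / 2 : ℝ) := by
      have hae : (fun p ↦ f p - c) =ᵐ[μ.restrict Z] fun _ ↦ -c := by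
        rw [EventuallyEq, ae_restrict_iff' hZm]
        refine Eventually.of_forall fun p hp ↦ ?_
        rw [hf0 p hp.2, zero_sub]
      rw [eLpNorm_congr_ae hae, eLpNorm_const _ (by norm_num)
        (fun h0 ↦ hμZ0 (Measure.restrict_eq_zero.1 h0)), Measure.restrict_apply_univ, enorm_neg]
      norm_num
    rw [← h1]
    exact (eLpNorm_mono_measure _ (Measure.restrict_mono inter_subset_left le_rfl)).trans hG
  have hcle : ‖c‖ₑ ≤ KG * DIR * (μ Z)⁻¹ ^ (1 / 2 : ℝ) := by
    have hZ2 : μ Z ^ (1 / 2 : ℝ) ≠ 0 := by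
      intro h0
      exact hμZ0 ((ENNReal.rpow_eq_zero_iff_of_pos (by norm_num)).1 h0)
    have hZ2t : μ Z ^ (1 / 2 : ℝ) ≠ ⊤ := ENNReal.rpow_ne_top_of_nonneg (by norm_num) hμZt
    calc ‖c‖ₑ = ‖c‖ₑ * μ Z ^ (1 / 2 : ℝ) * (μ Z ^ (1 / 2 : ℝ))⁻¹ := by
          rw [mul_assoc, ENNReal.mul_inv_cancel hZ2 hZ2t, mul_one]
      _ ≤ KG * DIR * (μ Z ^ (1 / 2 : ℝ))⁻¹ := mul_le_mul_left hcZ _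
      _ = KG * DIR * (μ Z)⁻¹ ^ (1 / 2 : ℝ) := by rw [ENNReal.inv_rpow]
  -- the `L²` norm
  have hL2 : eLpNorm f 2 μ ≤ K₂ * DIR := by
    have h0 : eLpNorm f 2 μ = eLpNorm f 2 (μ.restrict Ω) :=
      (eLpNorm_restrict_eq_of_support_subset hsuppΩ).symm
    have hfm : AEStronglyMeasurable (fun p ↦ f p - c) (μ.restrict Ω) :=
      (hfc.sub continuous_const).aestronglyMeasurable
    have h1 : eLpNorm f 2 (μ.restrict Ω) ≤
        eLpNorm (fun p ↦ f p - c) 2 (μ.restrict Ω) + eLpNorm (fun _ ↦ c) 2 (μ.restrict Ω) := by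
      have heq : f = (fun p ↦ f p - c) + fun _ ↦ c := by
        funext p
        simp
      conv_lhs => rw [heq]
      exact eLpNorm_add_le hfm aestronglyMeasurable_const one_le_two
    have h2 : eLpNorm (fun _ ↦ c) 2 (μ.restrict Ω) = ‖c‖ₑ * μ Ω ^ (1 / 2 : ℝ) := by
      rw [eLpNorm_const _ (by norm_num) (fun h0 ↦ hμΩ0 (Measure.restrict_eq_zero.1 h0)),
        Measure.restrict_apply_univ]
      norm_num
    calc eLpNorm f 2 μ = eLpNorm f 2 (μ.restrict Ω) := h0
      _ ≤ KG * DIR + ‖c‖ₑ * μ Ω ^ (1 / 2 : ℝ) := by rw [← h2]; exact h1.trans (add_le_add hG le_rfl)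
      _ ≤ KG * DIR + KG * DIR * (μ Z)⁻¹ ^ (1 / 2 : ℝ) * μ Ω ^ (1 / 2 : ℝ) := by
          gcongr
      _ = K₂ * DIR := by
          simp only [hK₂]
          ring
  -- the `L⁶` norm
  have hL6 : eLpNorm f 6 μ ≤ ∑ i, eLpNorm f 6 (μ.restrict (U i)) := by
    rw [← eLpNorm_restrict_eq_of_support_subset hsuppΩ]
    exact eLpNorm_restrict_le_sum_eLpNorm_restrict (S := U) (fun i ↦ (hpo (i : X)).measurableSet) hΩm
      hΩ.subset hfc.aestronglyMeasurable (by norm_num)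
  calc eLpNorm f 6 μ ≤ ∑ i, eLpNorm f 6 (μ.restrict (U i)) := hL6
    _ ≤ ∑ i, CS i * (DIR + eLpNorm f 2 μ) := Finset.sum_le_sum fun i _ ↦ hCS i f hf
    _ = (∑ i, CS i) * (DIR + eLpNorm f 2 μ) := by rw [Finset.sum_mul]
    _ ≤ (∑ i, CS i) * (DIR + K₂ * DIR) := by gcongr
    _ = C * DIR := by
        simp only [hC]
        ring

end Core

end AFEnd

end Literature.Geometry.Lorentzian

end
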